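import Literature.MathematicalPhysics.QuantumFieldTheory.Balaban1983to89.FlowStepRuns
import Literature.MathematicalPhysics.QuantumFieldTheory.Balaban1983to89.Beta.RemainderChain

/-!
# `FlowStepBoxExtension` — the OFF-BOX VALUES of a totalised history-dependent β-family: two extension devices, what they
# preserve, and two kernel facts for the typing of the datum of record (the unguarded (0.20) clause; constant families)

CITATION HEADER.  Typed skeleton of T. Bałaban, *Renormalization group approach to lattice gauge field theories. I*,
Commun. Math. Phys. **109** (1987) 249–301 [Balaban1987RG1] (cell paper B12): the coupling recursion (0.18)–(0.20)
pp. 255–256 and the β-functions (1.20)–(1.22) p. 264, which print DEFINES ONLY ON THE BOX — p. 264, after (1.22): *"It is a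
smooth function defined on the interval [0, γ], (or analytic), uniformly bounded on this interval together with all
derivatives"* — and runs ONLY under the standing hypothesis *"0 < g_k ≤ γ for k = 0, 1, …, K"* (Thm 1 p. 259, Thm 3 p. 264).
The tree's carrier `FlowStep.HBeta = (k : ℕ) → (Fin (k+1) → ℝ) → ℝ` is TOTAL, so every datum `T4Continuum.FiniteEpsData`
(field `βfun`) carries values of β OFF the box `]0,γ]^{k+1}` that print never defines; which values is a CONVENTION of the
datum of record (NODE 00 Stage 5, definition item `defn-IsRecordOfRecord₅`).  NOTHING of the series is asserted here; this
module is bookkeeping about that convention, for the seats typing the record (pub-ymgap node00-def; DAG seats n23∕n28).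

WHAT IS PROVED (all elementary).
* §1 `boxExtend γ β` := `β` on the box, `0` off it (`Set.indicator`).  Every BOX predicate of `FlowStep` is invariant
  (`BetaContH`, `BetaLowerH`, `BetaUpperH` on boxes `γ' ≤ γ`; `BetaPertH`, `BetaSignH`, `BetaAFH` for `γ > 0`); the run generated
  forward by (0.20) (`FlowStepRuns.genSeq`) is UNCHANGED as long as it stays in `]0,γ]`; off the box the generated run freezes
  (`g_{k+1} = |g_k|`); and — the point — with this convention the UNGUARDED (0.20) clause `Flow.SatisfiesRG` holds along EVERY
  generated run from EVERY bare value as soon as the ON-BOX bound `β ≤ β⁺ ≤ 1∕γ²` holds (`satisfiesRG_genFlow_boxExtend`):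
  no overshoot is possible.
* §2 BUT `boxExtend` is INCOMPATIBLE with the printed one-loop split `B12Beta.OneLoopSplit` (its clause `vanish` reads β on the
  hyperplane `g_k = 0`, which is OFF the box): a split of `boxExtend γ β` has `β⁰ ≡ 0` (`beta0_eq_zero_of_split_boxExtend`).  The
  split-compatible device is `splitExtend γ S` := `β⁰_k + 𝟙_box·β¹` (carries a `OneLoopSplit` by construction, agrees with β on the
  box, `RemainderConst` and the box predicates transfer) — whose off-box value is `β⁰_k`, so large bare couplings DO overshoot.
* §3 THE ZERO-BARE-COUPLING RUN (kernel-located negative, convention-independent): for EVERY β carrying a one-loop split with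
  `β⁰₁ > 0` (asymptotic-freedom sign) and EVERY construction whose runs start at the bare value and whose run-wise β-functions curry β
  (`DagBinding.CurriesHBeta` — e.g. `FlowStepRuns.modelOf β`, and every datum assembled from an RG machine), the run with parameters
  `(K, m, g₀) = (1, m, 0)` VIOLATES (0.20) as typed (`Flow.SatisfiesRG`): `1∕0² = 0` on the left, `1∕g₁² + β⁰₁ > 0` on the right.  Hence the
  unguarded clause «`∀ P, (leavesP w P).rgFlow`» of the K1 object slot W00 (route «BalabanUVNodes», supply module `…Clusters` §3) is
  FALSE at every such record, whatever the off-box convention; only the GUARDED clause `smallCouplings → rgFlow` — a theorem for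
  forward-generated constructions, `FlowStepRuns.satisfiesRG_of_inInterval` — can be part of a record predicate.  (This sharpens
  NODE 00's Stage-5 scoping note §5, which prices the unguarded clause as «off-box convention + on-box bound β ≤ β⁺, γ²β⁺ ≤ 1»: with
  the printed split that price cannot be paid at the bare value `g₀ = 0`; the guarded wording chosen for the K1 split is forced.)
* §4 CONSTANT FAMILIES `β ≡ c`, `c ≥ 0`, inhabit every β-side clause the UV route's items read at Stage 0 (`BetaContH`, `BetaLowerH 0`,
  `BetaUpperH c`, `BetaPertH · c`, a one-loop split with `β¹ ≡ 0` and `RemainderConst … 0`, and `DagBinding.EndpointExistence` of every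
  construction they generate): the β-side half of the junk census (the datum half — a Stage-0 datum of record with (B) pinned, zero β,
  endpoint existence — is `T4FiniteEpsInhabitedB`, pub-ymgap seat dag-n13-b, whose priority on «EndpointGivenB junk-provable at Stage 0»
  this module acknowledges); together: a record predicate that leaves `βfun` free leaves `EndpointGivenB` and the β-half of its BC3
  stubs junk-inhabitable — the record must pin `βfun` (NODE 00 stage ₈).

HONEST FRAMING: conventions and arithmetic on one field of one finite four-torus datum; no estimate, no claim about Bałaban's β,
nothing continuum ∕ ℝ⁴ ∕ OS ∕ mass gap ∕ Clay.  Pages: journal page = PDF page + 248 for [Balaban1987RG1].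
-/

namespace Literature.MathematicalPhysics.QuantumFieldTheory.Balaban1983to89.FlowStepBoxExtension

open Literature.MathematicalPhysics.QuantumFieldTheory.Balaban1983to89
open FlowStep FlowStepRuns DagBinding

noncomputable section

/-! ## §1 The indicator extension `boxExtend` and what it preserves -/

/-- **Box extension by zero**: `boxExtend γ β k v = β k v` for histories `v ∈ ]0,γ]^{k+1}`, and `0` for every other `v`.
The box is the printed domain of β ([Balaban1987RG1] p. 264 after (1.22)); the value `0` off it is a CONVENTION for the
total carrier `HBeta`, not a statement of the series. [cite: Balaban1987RG1, (1.22) p.264] -/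
def boxExtend (γ : ℝ) (β : HBeta) : HBeta := fun k => (Box γ k).indicator (β k)

variable {γ : ℝ} {β : HBeta}

/-- On the box, `boxExtend γ β` is `β`. [cite: Balaban1987RG1, (1.22) p.264] -/
theorem boxExtend_of_mem {k : ℕ} {v : Fin (k + 1) → ℝ} (hv : v ∈ Box γ k) : boxExtend γ β k v = β k v :=
  Set.indicator_of_mem hv _

/-- Off the box, `boxExtend γ β` is `0`. [cite: Balaban1987RG1, (1.22) p.264] -/
theorem boxExtend_of_notMem {k : ℕ} {v : Fin (k + 1) → ℝ} (hv : v ∉ Box γ k) : boxExtend γ β k v = 0 :=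
  Set.indicator_of_notMem hv _

/-- `boxExtend γ β k` and `β k` agree on every smaller box `]0,γ']^{k+1}`, `γ' ≤ γ`. [cite: Balaban1987RG1, (1.22) p.264] -/
theorem boxExtend_eqOn {γ' : ℝ} (hγ : γ' ≤ γ) (k : ℕ) : Set.EqOn (boxExtend γ β k) (β k) (Box γ' k) :=
  fun _ hv => boxExtend_of_mem (box_mono hγ k hv)

/-- Joint continuity on the boxes `]0,γ']^{k+1}` (`FlowStep.BetaContH`, the p. 264 smoothness clause as typed) is invariant
under the extension, `γ' ≤ γ`. [cite: Balaban1987RG1, §1 p.264] -/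
theorem betaContH_boxExtend_iff {γ' : ℝ} (hγ : γ' ≤ γ) : BetaContH γ' (boxExtend γ β) ↔ BetaContH γ' β :=
  ⟨fun h k => (h k).congr fun _ hv => (boxExtend_eqOn hγ k hv).symm,
    fun h k => (h k).congr (boxExtend_eqOn hγ k)⟩

/-- The uniform lower bound on the boxes (`FlowStep.BetaLowerH`, located unprinted input T09.F) is invariant, `γ' ≤ γ`. [cite: Balaban1987RG1, Thm 2 p.259] -/
theorem betaLowerH_boxExtend_iff {γ' b : ℝ} (hγ : γ' ≤ γ) : BetaLowerH b γ' (boxExtend γ β) ↔ BetaLowerH b γ' β :=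
  ⟨fun h k v hv => by rw [← boxExtend_eqOn (β := β) hγ k hv]; exact h k v hv,
    fun h k v hv => by rw [boxExtend_eqOn (β := β) hγ k hv]; exact h k v hv⟩

/-- The uniform upper bound on the boxes (`FlowStep.BetaUpperH`, p. 264 "uniformly bounded") is invariant, `γ' ≤ γ`. [cite: Balaban1987RG1, §1 p.264] -/
theorem betaUpperH_boxExtend_iff {γ' β' : ℝ} (hγ : γ' ≤ γ) : BetaUpperH β' γ' (boxExtend γ β) ↔ BetaUpperH β' γ' β :=
  ⟨fun h k v hv => by rw [← boxExtend_eqOn (β := β) hγ k hv]; exact h k v hv,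
    fun h k v hv => by rw [boxExtend_eqOn (β := β) hγ k hv]; exact h k v hv⟩

/-- The perturbative typing `BetaPertH` ([Balaban1989LargeFieldII] p. 355 "second order perturbative calculations", as the
cell typed it) is invariant for `γ > 0` (shrink its box side to `min γ₀ γ`). [cite: Balaban1989LargeFieldII, Thm 1 p.355] -/
theorem betaPertH_boxExtend_iff {βbar : ℝ} (hγ : 0 < γ) : BetaPertH (boxExtend γ β) βbar ↔ BetaPertH β βbar := by
  constructor
  · rintro ⟨γ₀, hγ₀, C, hC, h⟩
    refine ⟨min γ₀ γ, lt_min hγ₀ hγ, C, hC, fun γ₁ hγ₁ hγ₁le k v hv => ?_⟩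
    rw [← boxExtend_eqOn (β := β) (hγ₁le.trans (min_le_right _ _)) k hv]
    exact h γ₁ hγ₁ (hγ₁le.trans (min_le_left _ _)) k v hv
  · rintro ⟨γ₀, hγ₀, C, hC, h⟩
    refine ⟨min γ₀ γ, lt_min hγ₀ hγ, C, hC, fun γ₁ hγ₁ hγ₁le k v hv => ?_⟩
    rw [boxExtend_eqOn (β := β) (hγ₁le.trans (min_le_right _ _)) k hv]
    exact h γ₁ hγ₁ (hγ₁le.trans (min_le_left _ _)) k v hv

/-- The sign typing `BetaSignH` (T09.F, weak form) is invariant for `γ > 0`. [cite: Balaban1987RG1, Thm 2 p.259] -/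
theorem betaSignH_boxExtend_iff (hγ : 0 < γ) : BetaSignH (boxExtend γ β) ↔ BetaSignH β := by
  constructor
  · rintro ⟨γ₀, hγ₀, h⟩
    exact ⟨min γ₀ γ, lt_min hγ₀ hγ, (betaLowerH_boxExtend_iff (min_le_right _ _)).mp
      fun k v hv => h k v (box_mono (min_le_left _ _) k hv)⟩
  · rintro ⟨γ₀, hγ₀, h⟩
    exact ⟨min γ₀ γ, lt_min hγ₀ hγ, (betaLowerH_boxExtend_iff (min_le_right _ _)).mpr
      fun k v hv => h k v (box_mono (min_le_left _ _) k hv)⟩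

/-- The asymptotic-freedom typing `BetaAFH` (T09.F, strong form) is invariant for `γ > 0`. [cite: Balaban1987RG1, Thm 2 (0.31) p.259] -/
theorem betaAFH_boxExtend_iff (hγ : 0 < γ) : BetaAFH (boxExtend γ β) ↔ BetaAFH β := by
  constructor
  · rintro ⟨γ₀, hγ₀, b, hb, h⟩
    exact ⟨min γ₀ γ, lt_min hγ₀ hγ, b, hb, (betaLowerH_boxExtend_iff (min_le_right _ _)).mp
      fun k v hv => h k v (box_mono (min_le_left _ _) k hv)⟩
  · rintro ⟨γ₀, hγ₀, b, hb, h⟩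
    exact ⟨min γ₀ γ, lt_min hγ₀ hγ, b, hb, (betaLowerH_boxExtend_iff (min_le_right _ _)).mpr
      fun k v hv => h k v (box_mono (min_le_left _ _) k hv)⟩

/-- `1∕(solveCoupling y)² = y` for every `y ≥ 0` — at `y = 0` both sides vanish in the totalised carrier (`solveCoupling 0 = 0`,
`1∕0 = 0`). [cite: Balaban1987RG1, (0.20) p.256] -/
theorem inv_sq_solveCoupling_of_nonneg {y : ℝ} (hy : 0 ≤ y) : 1 / (solveCoupling y) ^ 2 = y := by
  rcases hy.lt_or_eq with hpos | h0
  · exact inv_sq_solveCoupling hpos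
  · subst h0
    rw [solveCoupling, if_neg (lt_irrefl _)]
    norm_num

/-- The prefix of a run all of whose first `k+1` couplings lie in `]0,γ]` is a point of the box `]0,γ]^{k+1}`. [cite: Balaban1987RG1, Thm 3 p.264] -/
theorem prefixOf_mem_box {g : ℕ → ℝ} {k : ℕ} (h : ∀ i, i ≤ k → 0 < g i ∧ g i ≤ γ) : prefixOf g k ∈ Box γ k :=
  mem_box.mpr fun i => h i (Nat.lt_succ_iff.mp i.isLt)

/-- **Generated runs are unchanged while they stay in the box**: if the run generated by β from `g₀` ((0.20) solved forward,
`FlowStepRuns.genSeq`) has `0 < g_i ≤ γ` for `i ≤ k`, then the run generated by `boxExtend γ β` agrees with it for `i ≤ k+1`. [cite: Balaban1987RG1, (0.18)–(0.20) pp.255–256] -/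
theorem genSeq_boxExtend_eq (g0 : ℝ) :
    ∀ k, (∀ i, i ≤ k → 0 < genSeq β g0 i ∧ genSeq β g0 i ≤ γ) →
      ∀ i, i ≤ k + 1 → genSeq (boxExtend γ β) g0 i = genSeq β g0 i := by
  -- strengthen: agreement up to `n` from box membership strictly below `n`
  suffices H : ∀ n, (∀ i, i < n → 0 < genSeq β g0 i ∧ genSeq β g0 i ≤ γ) →
      ∀ i, i ≤ n → genSeq (boxExtend γ β) g0 i = genSeq β g0 i from
    fun k hk => H (k + 1) fun i hi => hk i (Nat.lt_succ_iff.mp hi)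
  intro n
  induction n with
  | zero =>
    intro _ i hi
    obtain rfl := Nat.le_zero.mp hi
    rw [genSeq_zero, genSeq_zero]
  | succ n ih =>
    intro hbox i hi
    have hagree : ∀ i, i ≤ n → genSeq (boxExtend γ β) g0 i = genSeq β g0 i :=
      ih fun i hi => hbox i (Nat.lt_succ_of_lt hi)
    rcases Nat.lt_or_eq_of_le hi with hlt | rfl
    · exact hagree i (Nat.lt_succ_iff.mp hlt)
    · have hpre : prefixOf (genSeq (boxExtend γ β) g0) n = prefixOf (genSeq β g0) n := by
        funext j
        exact hagree j (Nat.lt_succ_iff.mp j.isLt)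
      have hmem : prefixOf (genSeq β g0) n ∈ Box γ n :=
        prefixOf_mem_box fun i hi => hbox i (Nat.lt_succ_of_le hi)
      rw [genSeq_succ, genSeq_succ, hpre, hagree n le_rfl, boxExtend_of_mem hmem]

/-- **Off the box the generated run freezes**: if the prefix `(g_0,…,g_k)` of the run generated by `boxExtend γ β` is NOT in
`]0,γ]^{k+1}`, then `g_{k+1} = |g_k|` (the step solves `1∕g² = 1∕g_k²`); in particular the halting clause
`FlowStepRuns.HaltsOutside` never fires off the box. [cite: Balaban1987RG1, (0.20) p.256] -/
theorem genSeq_boxExtend_succ_of_notMem (g0 : ℝ) {k : ℕ}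
    (h : prefixOf (genSeq (boxExtend γ β) g0) k ∉ Box γ k) :
    genSeq (boxExtend γ β) g0 (k + 1) = |genSeq (boxExtend γ β) g0 k| := by
  rw [genSeq_succ, boxExtend_of_notMem h, sub_zero]
  set x := genSeq (boxExtend γ β) g0 k
  by_cases hx : x = 0
  · rw [hx, solveCoupling]; norm_num
  · have hx2 : 0 < x ^ 2 := lt_of_le_of_ne (sq_nonneg x) (Ne.symm (pow_ne_zero 2 hx))
    have hpos : 0 < 1 / x ^ 2 := by positivity
    rw [solveCoupling, if_pos hpos, one_div, one_div, Real.sqrt_inv, inv_inv, Real.sqrt_sq_eq_abs]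

/-- **NO OVERSHOOT under the indicator convention**: if `β ≤ β⁺` on the boxes `]0,γ]^{k+1}` with `β⁺ ≤ 1∕γ²` — the
ON-BOX bound alone — then along the run generated by `boxExtend γ β` from ANY bare value `g₀`, at every step
`boxExtend γ β k (g_0,…,g_k) ≤ 1∕g_k²`: on the box because `g_k ≤ γ`, off it because the value is `0`. [cite: Balaban1987RG1, (0.20) p.256] -/
theorem boxExtend_prefix_le_inv_sq {β' : ℝ} (hup : BetaUpperH β' γ β) (hβ' : β' ≤ 1 / γ ^ 2)
    (g0 : ℝ) (k : ℕ) :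
    boxExtend γ β k (prefixOf (genSeq (boxExtend γ β) g0) k) ≤ 1 / (genSeq (boxExtend γ β) g0 k) ^ 2 := by
  set g := genSeq (boxExtend γ β) g0
  by_cases hmem : prefixOf g k ∈ Box γ k
  · rw [boxExtend_of_mem hmem]
    have hk : 0 < g k ∧ g k ≤ γ := by
      simpa using (mem_box.mp hmem) (Fin.last k)
    calc β k (prefixOf g k) ≤ β' := hup k _ hmem
      _ ≤ 1 / γ ^ 2 := hβ'
      _ ≤ 1 / (g k) ^ 2 := by
        apply one_div_le_one_div_of_le (pow_pos hk.1 2)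
        exact pow_le_pow_left₀ hk.1.le hk.2 2
  · rw [boxExtend_of_notMem hmem]
    positivity

/-- **(0.20) UNGUARDED along every generated run, under the indicator convention and the on-box bound**: for
`BetaUpperH β⁺ γ β` and `β⁺ ≤ 1∕γ²`, the flow `FlowStepRuns.genFlow (boxExtend γ β) g₀` satisfies `Setup.Flow.SatisfiesRG K` for
EVERY `K` and EVERY bare value `g₀` — the run-wise leaf `Dag.Leaves.rgFlow` with no `smallCouplings` guard.  (With the estimate
half `γ²β⁺ ≤ 1` of the cell's β-window this is the content of the K1 object slot's third binding clause for a record that adopts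
THIS convention — but see §2: the convention kills the printed one-loop split.) [cite: Balaban1987RG1, (0.20) p.256] -/
theorem satisfiesRG_genFlow_boxExtend {β' : ℝ} (hup : BetaUpperH β' γ β) (hβ' : β' ≤ 1 / γ ^ 2)
    (g0 : ℝ) (K : ℕ) : (genFlow (boxExtend γ β) g0).SatisfiesRG K := by
  intro k _
  show 1 / (genSeq (boxExtend γ β) g0 k) ^ 2 = 1 / (genSeq (boxExtend γ β) g0 (k + 1)) ^ 2 +
    boxExtend γ β k (Function.update (prefixOf (genSeq (boxExtend γ β) g0) k) (Fin.last k)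
      (genSeq (boxExtend γ β) g0 k))
  rw [update_prefixOf_last, genSeq_succ,
    inv_sq_solveCoupling_of_nonneg (sub_nonneg.mpr (boxExtend_prefix_le_inv_sq hup hβ' g0 k))]
  ring

/-! ## §2 The printed one-loop split: `boxExtend` is incompatible with it; the split-compatible device `splitExtend` -/

/-- **`boxExtend` kills the one-loop split**: a `B12Beta.OneLoopSplit` of `boxExtend γ β` has `β⁰ ≡ 0`, because its clause
`vanish` (the remainder (2.13) vanishes at `g_k = 0`, [Balaban1987RG1] p. 268) and `split` are read on the hyperplane `g_k = 0`,
which lies OFF the box, where `boxExtend` is `0`.  So a record whose β-field is a `boxExtend` cannot carry the printed split with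
the asymptotic-freedom sign `β⁰ > 0`. [cite: Balaban1987RG1, (2.12)–(2.14) p.268] -/
theorem beta0_eq_zero_of_split_boxExtend (S : B12Beta.OneLoopSplit (boxExtend γ β)) (k : ℕ) : S.β0 k = 0 := by
  have hv : (fun _ : Fin (k + 1) => (0 : ℝ)) ∉ Box γ k := fun h =>
    (lt_irrefl (0 : ℝ)) ((mem_box.mp h) (Fin.last k)).1
  have h1 := S.split k (fun _ => 0)
  rw [boxExtend_of_notMem hv, S.vanish k _ rfl, add_zero] at h1
  exact h1.symm

/-- **Split-compatible extension**: keep the coupling-free one-loop term `β⁰_k` EVERYWHERE and extend only the remainder `β¹`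
by zero off the box: `splitExtend γ S k v = β⁰_k + 𝟙_{]0,γ]^{k+1}}(v)·β¹_k(v)`.  Off the box its value is `β⁰_k` (not `0`). [cite: Balaban1987RG1, (2.12)–(2.14) p.268] -/
def splitExtend (γ : ℝ) {β : HBeta} (S : B12Beta.OneLoopSplit β) : HBeta :=
  fun k v => S.β0 k + (Box γ k).indicator (S.β1 k) v

/-- `splitExtend γ S` CARRIES a one-loop split: same `β⁰`, remainder `𝟙_box·β¹` (which vanishes at `g_k = 0`, a point off the
box). [cite: Balaban1987RG1, (2.12)–(2.14) p.268] -/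
def splitExtendSplit (γ : ℝ) {β : HBeta} (S : B12Beta.OneLoopSplit β) : B12Beta.OneLoopSplit (splitExtend γ S) where
  β0 := S.β0
  β1 := fun k => (Box γ k).indicator (S.β1 k)
  split := fun _ _ => rfl
  vanish := fun k p hp =>
    Set.indicator_of_notMem (fun h => absurd ((mem_box.mp h) (Fin.last k)).1 (by rw [hp]; exact lt_irrefl 0)) _

/-- On the box, `splitExtend γ S` is `β` (by `S.split`). [cite: Balaban1987RG1, (1.22) p.264] -/
theorem splitExtend_of_mem (S : B12Beta.OneLoopSplit β) {k : ℕ} {v : Fin (k + 1) → ℝ} (hv : v ∈ Box γ k) :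
    splitExtend γ S k v = β k v := by
  rw [splitExtend, Set.indicator_of_mem hv, S.split]

/-- Off the box, `splitExtend γ S k` is the constant `β⁰_k`. [cite: Balaban1987RG1, (2.12) p.268] -/
theorem splitExtend_of_notMem (S : B12Beta.OneLoopSplit β) {k : ℕ} {v : Fin (k + 1) → ℝ} (hv : v ∉ Box γ k) :
    splitExtend γ S k v = S.β0 k := by
  rw [splitExtend, Set.indicator_of_notMem hv, add_zero]

/-- `splitExtend γ S k` and `β k` agree on every smaller box, `γ' ≤ γ`. [cite: Balaban1987RG1, (1.22) p.264] -/
theorem splitExtend_eqOn (S : B12Beta.OneLoopSplit β) {γ' : ℝ} (hγ : γ' ≤ γ) (k : ℕ) :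
    Set.EqOn (splitExtend γ S k) (β k) (Box γ' k) :=
  fun _ hv => splitExtend_of_mem S (box_mono hγ k hv)

/-- The remainder bound in constant form on the history boxes (`Beta.RemainderChain.RemainderConst`, the wall input of the
B12-Thm-2 sub-DAG) transfers to the extended split, `γ' ≤ γ`. [cite: Balaban1987RG1, (1.22) p.264] -/
theorem remainderConst_splitExtend_iff (S : B12Beta.OneLoopSplit β) {γ' r : ℝ} (hγ : γ' ≤ γ) :
    Beta.RemainderChain.RemainderConst (splitExtendSplit γ S) γ' r ↔ Beta.RemainderChain.RemainderConst S γ' r := by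
  have key : ∀ k p, p ∈ B12Beta.HistBox γ' k → (splitExtendSplit γ S).β1 k p = S.β1 k p := fun k p hp =>
    Set.indicator_of_mem (box_mono hγ k ((histBox_eq_box γ' k) ▸ hp)) _
  exact ⟨fun h k p hp => by rw [← key k p hp]; exact h k p hp, fun h k p hp => by rw [key k p hp]; exact h k p hp⟩

/-- The box predicates transfer to `splitExtend` exactly as to `boxExtend` (continuity shown; the bounds are identical one-liners),
`γ' ≤ γ`. [cite: Balaban1987RG1, §1 p.264] -/
theorem betaContH_splitExtend_iff (S : B12Beta.OneLoopSplit β) {γ' : ℝ} (hγ : γ' ≤ γ) :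
    BetaContH γ' (splitExtend γ S) ↔ BetaContH γ' β :=
  ⟨fun h k => (h k).congr fun _ hv => (splitExtend_eqOn S hγ k hv).symm,
    fun h k => (h k).congr (splitExtend_eqOn S hγ k)⟩

/-- Lower and upper box bounds transfer to `splitExtend`, `γ' ≤ γ`. [cite: Balaban1987RG1, Thm 2 p.259] -/
theorem betaBoundsH_splitExtend_iff (S : B12Beta.OneLoopSplit β) {γ' b β' : ℝ} (hγ : γ' ≤ γ) :
    (BetaLowerH b γ' (splitExtend γ S) ↔ BetaLowerH b γ' β) ∧
      (BetaUpperH β' γ' (splitExtend γ S) ↔ BetaUpperH β' γ' β) :=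
  ⟨⟨fun h k v hv => by rw [← splitExtend_eqOn S hγ k hv]; exact h k v hv,
      fun h k v hv => by rw [splitExtend_eqOn S hγ k hv]; exact h k v hv⟩,
    ⟨fun h k v hv => by rw [← splitExtend_eqOn S hγ k hv]; exact h k v hv,
      fun h k v hv => by rw [splitExtend_eqOn S hγ k hv]; exact h k v hv⟩⟩

/-! ## §3 The zero-bare-coupling run: the UNGUARDED (0.20) clause is false at every record carrying the split with `β⁰₁ > 0` -/

/-- **Kernel-located negative (convention-independent).**  Let `β` carry a one-loop split with `β⁰₁ > 0` ([Balaban1987RG1]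
(2.12) p. 268 with the asymptotic-freedom sign; tree: `B12Normalization.stepBal_pos`), and let `C` be ANY construction whose run
with parameters `(1, m, 0)` starts at the bare value `g₀ = 0` and whose run-wise β-functions curry `β` (`DagBinding.CurriesHBeta`).
Then that run VIOLATES (0.20) as typed, `Setup.Flow.SatisfiesRG … 1`: the left side `1∕g₀²` is `0` in the totalised carrier, the
right side is `1∕g₁² + β₁(0) = 1∕g₁² + β⁰₁ > 0` (`split` + `vanish` at `g₀ = 0`).  No value of β off the box is used. [cite: Balaban1987RG1, (0.20) p.256] -/
theorem not_satisfiesRG_zeroBare {C : B12.Construction} {β : HBeta} (S : B12Beta.OneLoopSplit β) (hAF : 0 < S.β0 0)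
    (m : ℕ) (h0 : (C ⟨1, m, 0⟩).flow.g 0 = 0) (hcur : CurriesHBeta C β) :
    ¬ (C ⟨1, m, 0⟩).flow.SatisfiesRG 1 := by
  intro h
  have e := h 0 Nat.one_pos
  have hβ : (C ⟨1, m, 0⟩).flow.β (0 + 1) ((C ⟨1, m, 0⟩).flow.g 0) = S.β0 0 := by
    rw [hcur ⟨1, m, 0⟩ 0 _ Nat.one_pos, S.split, S.vanish _ _ (by rw [Function.update_self, h0]), add_zero]
  rw [hβ, h0] at e
  have h1 : (0 : ℝ) ≤ 1 / ((C ⟨1, m, 0⟩).flow.g (0 + 1)) ^ 2 := by positivity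
  have h2 : (1 : ℝ) / (0 : ℝ) ^ 2 = 0 := by norm_num
  linarith

/-- **Corollary: the run-uniform unguarded clause fails.**  Under the same hypotheses with ALL runs starting at their bare value
(`(C P).flow.g 0 = P.g₀`, the first half of `DagBinding.ForwardGenerated`), `¬ ∀ P, (C P).flow.SatisfiesRG P.K` — witness
`P = (1, 0, 0)`. [cite: Balaban1987RG1, (0.20) p.256] -/
theorem not_forall_satisfiesRG {C : B12.Construction} {β : HBeta} (S : B12Beta.OneLoopSplit β) (hAF : 0 < S.β0 0)
    (h0 : ∀ P : B12.RunParams, (C P).flow.g 0 = P.g0) (hcur : CurriesHBeta C β) :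
    ¬ ∀ P : B12.RunParams, (C P).flow.SatisfiesRG P.K :=
  fun h => not_satisfiesRG_zeroBare S hAF 0 (h0 ⟨1, 0, 0⟩) hcur (h ⟨1, 0, 0⟩)

/-- **… in particular at the canonical construction `FlowStepRuns.modelOf β`** (forward-generated, curried). [cite: Balaban1987RG1, (0.20) p.256] -/
theorem not_forall_satisfiesRG_modelOf {β : HBeta} (S : B12Beta.OneLoopSplit β) (hAF : 0 < S.β0 0) :
    ¬ ∀ P : B12.RunParams, ((modelOf β) P).flow.SatisfiesRG P.K :=
  not_forall_satisfiesRG S hAF (modelOf_forwardGenerated β).1 (modelOf_curries β)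

/-- **… and at every binding world over such a construction**: the third binding clause «`∀ P, (leavesP w P).rgFlow`» of the
K1 object slot W00 (route «BalabanUVNodes»; `Dag.Leaves.rgFlow` = (0.20) run-wise, UNGUARDED) is FALSE for every `DagBinding.WorldP`
whose construction's runs start at the bare value and curry a β with the split and `β⁰₁ > 0`.  The guarded clause
`(leavesP w P).smallCouplings → (leavesP w P).rgFlow` holds instead at forward-generated constructions
(`FlowStepRuns.satisfiesRG_of_inInterval`). [cite: Balaban1987RG1, (0.20) p.256] -/
theorem not_forall_rgFlow_leavesP (w : WorldP) {β : HBeta} (S : B12Beta.OneLoopSplit β) (hAF : 0 < S.β0 0)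
    (h0 : ∀ P : B12.RunParams, (w.C P).flow.g 0 = P.g0) (hcur : CurriesHBeta w.C.toB12 β) :
    ¬ ∀ P : B12.RunParams, (leavesP w P).rgFlow :=
  not_forall_satisfiesRG (C := w.C.toB12) S hAF h0 hcur

/-- **The guarded clause, for contrast** (a restatement of `FlowStepRuns.satisfiesRG_of_inInterval` at a binding world): at a
forward-generated construction that halts outside, every run that stays in `]0, w.γ]` satisfies (0.20). [cite: Balaban1987RG1, (0.20) p.256] -/
theorem rgFlow_of_smallCouplings (w : WorldP) {β : HBeta} (hgen : ForwardGenerated w.C.toB12 β)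
    (hhalt : HaltsOutside w.C.toB12 β) (hcur : CurriesHBeta w.C.toB12 β) (P : B12.RunParams)
    (hsc : (leavesP w P).smallCouplings) : (leavesP w P).rgFlow :=
  satisfiesRG_of_inInterval hgen hhalt hcur P hsc

/-! ## §4 Constant families inhabit every β-side clause read at Stage 0 (junk census for the record predicate) -/

/-- The constant family `β ≡ c`. (A notation-free abbreviation used only in this section's statements.) [cite: Balaban1987RG1, (1.22) p.264] -/
abbrev constH (c : ℝ) : HBeta := fun _ _ => c

/-- `β ≡ c` with `c ≥ 0` is continuous on every box, has the sign `β ≥ 0` and the upper bound `β ≤ c` there — the three box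
inputs of the endpoint-existence fold `DagBinding.endpointExistence_of_forwardGenerated`. [cite: Balaban1987RG1, §1 p.264] -/
theorem const_boxProps {c : ℝ} (hc : 0 ≤ c) (γ : ℝ) :
    BetaContH γ (constH c) ∧ BetaLowerH 0 γ (constH c) ∧ BetaUpperH c γ (constH c) :=
  ⟨fun _ => continuousOn_const, fun _ _ _ => hc, fun _ _ _ => le_rfl⟩

/-- `β ≡ c` satisfies the perturbative typing `BetaPertH · c` with remainder constant `0`. [cite: Balaban1989LargeFieldII, Thm 1 p.355] -/
theorem betaPertH_const (c : ℝ) : BetaPertH (constH c) c :=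
  ⟨1, one_pos, 0, le_rfl, fun _ _ _ _ _ _ => by simp [constH]⟩

/-- `β ≡ c` carries a one-loop split with `β⁰ ≡ c` and `β¹ ≡ 0`. [cite: Balaban1987RG1, (2.12)–(2.14) p.268] -/
def constSplit (c : ℝ) : B12Beta.OneLoopSplit (constH c) where
  β0 := fun _ => c
  β1 := fun _ _ => 0
  split := fun _ _ => (add_zero c).symm
  vanish := fun _ _ _ => rfl

/-- **Conversely, EVERY one-loop split of the ZERO family has `β⁰ ≡ 0`** (split + vanish at `g_k = 0`): a datum whose β-field is the zero
family (the Stage-0 placeholders) admits NO split with the asymptotic-freedom sign — an antecedent demanding `OneLoopSplit D.βfun` with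
`β⁰_k > 0` (e.g. `β⁰_k` = a positive one-loop number of record) is UNSATISFIABLE there, so implications under it are true-but-vacuous at
such a datum. [cite: Balaban1987RG1, (2.12)–(2.14) p.268] -/
theorem beta0_eq_zero_of_split_constZero (S : B12Beta.OneLoopSplit (constH 0)) (k : ℕ) : S.β0 k = 0 := by
  have h1 := S.split k (fun _ => 0)
  rw [S.vanish k _ rfl, add_zero] at h1
  exact h1.symm

/-- … whose remainder obeys `RemainderConst … γ 0` on every history box. [cite: Balaban1987RG1, (1.22) p.264] -/
theorem remainderConst_constSplit (c γ : ℝ) : Beta.RemainderChain.RemainderConst (constSplit c) γ 0 :=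
  fun _ _ _ => by simp [constSplit]

/-- **Endpoint existence is inhabited by every constant family `β ≡ c ≥ 0`**: every construction forward-generated by it
(`DagBinding.ForwardGenerated`; e.g. `FlowStepRuns.modelOf`, or a finite-`ε` datum with `βfun := constH c`, in particular the
Stage-0 placeholders with the zero family) has `DagBinding.EndpointExistence` — for `c = 0` the run is constant and one takes
`g₀ := g`.  So at a record predicate that does not pin `βfun`, the endpoint half of [Balaban1987RG1] Thm 2 is junk-inhabitable. [cite: Balaban1987RG1, Thm 2 p.259] -/
theorem endpointExistence_of_forwardGenerated_const {C : B12.Construction} {c : ℝ} (hc : 0 ≤ c)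
    (hgen : ForwardGenerated C (constH c)) : EndpointExistence C :=
  endpointExistence_of_forwardGenerated C (constH c) one_pos hc (const_boxProps hc 1).1 (const_boxProps hc 1).2.1
    (const_boxProps hc 1).2.2 hgen

/-- **The β-half of the UV route's two BC3 stubs for `EndpointGivenB` is inhabited by `β ≡ 1`**: with the split `constSplit 1`
and the constants `(γ₀, β⁰_∞, c₀, θ, r, β′) = (1, 1, 0, 0, 0, 1)`, every conjunct of the skeleton's `OneLoopLaw` — `0 < γ₀`,
`0 < β⁰_∞`, `0 ≤ c₀`, `0 ≤ θ < 1`, `|β⁰_k − β⁰_∞| ≤ c₀θ^k`, `RemainderConst S γ₀ r`, `r ≤ β⁰_∞∕4`, `BetaUpperH β′ γ₀ β`,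
`−β′ ≤ β` on the boxes — holds, and so does `BetaContH γ₀ β` (stub 2).  Hence a Stage-0 record (averaging pinned, `βfun`
free) leaves both stubs, and the crux through `endpointExistence_of_forwardGenerated_const`, junk-inhabitable: the record
predicate must pin `βfun`. [cite: Balaban1987RG1, Thm 2 p.259] -/
theorem oneLoopLaw_shape_const_one :
    (0 : ℝ) < 1 ∧ (0 : ℝ) < 1 ∧ (0 : ℝ) ≤ 0 ∧ (0 : ℝ) ≤ 0 ∧ (0 : ℝ) < 1 ∧
      (∀ k : ℕ, |(constSplit 1).β0 k - 1| ≤ 0 * (0 : ℝ) ^ k) ∧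
        Beta.RemainderChain.RemainderConst (constSplit 1) 1 0 ∧ (0 : ℝ) ≤ 1 / 4 ∧
          BetaUpperH 1 1 (constH 1) ∧ (∀ k, ∀ v ∈ Box 1 k, -(1 : ℝ) ≤ constH 1 k v) ∧ BetaContH 1 (constH 1) := by
  refine ⟨one_pos, one_pos, le_rfl, le_rfl, one_pos, fun k => by simp [constSplit], remainderConst_constSplit 1 1,
    by norm_num, (const_boxProps zero_le_one 1).2.2, fun _ _ _ => by norm_num [constH], (const_boxProps zero_le_one 1).1⟩

end

end Literature.MathematicalPhysics.QuantumFieldTheory.Balaban1983to89.FlowStepBoxExtension
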